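import Summits.QuantumFields.BalabanUV.T4Continuum.Support.SmallCouplingEntryDecayGrad
import Summits.QuantumFields.BalabanUV.T4Continuum.Support.BlockPairingGeometry

/-!
# T⁴ programme, NE2 (U1a) sub-row Δ3 (`T4-U1a.S-NE2-D3-WALK°`) — THE SHIFT-CONJUGATION CALCULUS: SANDWICHED first-order perturbations
# `Σ_ν A_ν·(∇_ν ⊗ 1)·B_ν + C₀` REDUCE to the left class of file 2, the price being EXACTLY an `η`-Lipschitz bound on the right kernels

NE2 formalisation swarm `b2b-balaban-t4-ne2-formalise-*`, leaf prover 05 (gen 6); file 3 of the supplier item «NE2-Δ3-GRAD-TRANSPORT».  File 2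
(`Support/SmallCouplingEntryDecayGrad`) gave `hdec` at small coupling for `P_k = Σ_ν C_ν k·(∇_ν ⊗ 1) + C₀ k` (LEFT coefficient kernels).
Covariant first-order terms come SANDWICHED — a transporter-valued kernel on either side of the difference.  THIS FILE records the algebra
that moves the right kernel to the left and identifies the cost:
 * §1 `smul_sub_one_mul_eq`: for any `S` with `SᴴS = 1`, any `B`, `c`: `c(S − 1)·B = (S B Sᴴ)·c(S − 1) + c·(S B Sᴴ − B)` — i.e.
   **`∇_ν·B = B^{sh}·∇_ν + n·(B^{sh} − B)`**, `B^{sh} := S_ν B S_νᴴ` the kernel with BOTH indices translated by `e_ν` (pure ring algebra);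
 * §2 on King's tower: `fdiff_kron_eq` (`∇_ν ⊗ 1 = n·(S_ν ⊗ 1 − 1)`), `conjTranspose_shiftK_mul` (`(S_ν ⊗ 1)ᴴ(S_ν ⊗ 1) = 1`, the tree's
   `BlockPairingGeometry.conjTranspose_shiftM_mul`), **`fdiff_kron_mul_eq`**, the regrouping **`sandwich_eq`**:
   `Σ_ν A_ν·(∇_ν⊗1)·B_ν + C₀ = Σ_ν (A_ν B_ν^{sh})·(∇_ν⊗1) + (Σ_ν n_k·A_ν(B_ν^{sh} − B_ν) + C₀)`, and `shiftK_mul_diagonal_mul_conjTranspose`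
   (`(S_ν⊗1)·diag(b)·(S_ν⊗1)ᴴ = diag(b ∘ σ_ν)`: for multiplication operators `n_k·(B^{sh} − B) = diag` of forward difference quotients);
 * §3 **`hdec_pertCovC_sandwich`**: `hdec` at small coupling for the SANDWICHED class from file 2's `hdec_pertCovC_firstOrder`, with the
   displayed level-uniform weighted row bounds `κ_A` (left kernels), `κ_B` (translated right kernels `B^{sh}`), **`κ_L` for `n_k·(B^{sh} − B)`
   — the `η`-LIPSCHITZ CONSTANT OF THE RIGHT KERNEL ALONG THE DIAGONAL TRANSLATION** (for a multiplication operator `diag b`: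
   `n_k·|b(x + e_ν) − b(x)| ≤ κ_L`, the shape of [B9]'s regularity class (3.35)) — and `κ₀`; coupling threshold
   `‖t‖·[(d+1)κ_Aκ_B·B_∇K_{d+1}(δ_∇ − δ′) + ((d+1)κ_Aκ_L + κ₀)·W_G(δ′)] < 1`; packaged `∃ B_∇ δ_∇ > 0` form **`hdec_pertCovC_sandwich_cubic`**;
   kernel `example`: inhabited by transporter-like multipliers `Σ_ν diag(a_ν)·(∇_ν⊗1)·diag(b_ν)` with `‖a‖_∞ ≤ α`, `‖b‖_∞ ≤ β`, `n_k|b(x+e_ν) − b(x)| ≤ λ`.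
So in the weighted row-sum currency NO bound on `𝒢∇*` ((1.110) third entry) is ever needed for `P·𝒢`: left OR right placement of the
difference lands on ROW sums of `∇𝒢` (file 1), the right placement at the price `κ_L`.

HONEST FRAMING (T4-DAG p. 1).  MODEL level (kernels bounded in the weighted `ℓ^∞ → ℓ^∞` norm + the displayed `η`-Lipschitz bound) — NOT tier
B's `balabanPert` (no identification of its summands with this class is asserted: B0 is the b05/an2 lineages' reading, c5); `U = 1` propagators,
`a = 1`, CUBIC unit tori; constants crude; nothing printed asserted ([B5] (1.110) p.35, [B9] (3.35) p.396 are TEXT LOCATIONS); sub-row Δ3 NOT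
closed for Bałaban's carrier; **NE2 (U1a) NOT PROVED**; spine PROVED 0/9; NOT infinite volume, NOT a mass gap, NOT Clay.  HONEST DEPENDENCY:
continuum YM on T⁴ ⇐ BetaPertH ∧ nine spine estimates (0/9 proved); BetaPertH ⇐ (D1) ∧ (D4) ∧ CAP+tail; G-an2-4 gates asym, D1 and NE2/3/4.
ABSOLUTE RULE kept; no `def`; no `sorry`.
-/

noncomputable section

open scoped BigOperators ComplexConjugate Matrix Kronecker
open Finset

namespace Summit.QuantumFields.BalabanUV.T4Continuum.SmallCouplingEntryDecaySandwich

open Literature.MathematicalPhysics.QuantumFieldTheory.Balaban1983to89.B5Prop11Plancherel (Tor fine shiftM fdiff unitVec)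
open Literature.MathematicalPhysics.QuantumFieldTheory.Balaban1983to89.B5G183RateUnitTower (lev)
open Literature.MathematicalPhysics.QuantumFieldTheory.Balaban1983to89.B4TorusKernel (periodConst)
open Literature.MathematicalPhysics.QuantumFieldTheory.Balaban1983to89.B4TorusKernel.MultiPeriod (torusSupNorm)
open Literature.MathematicalPhysics.QuantumFieldTheory.Balaban1983to89.B4Sect5Proof (latticeConst)
open Literature.MathematicalPhysics.QuantumFieldTheory.Balaban1983to89.B5Blocks16 (blockOf)
open Literature.MathematicalPhysics.QuantumFieldTheory.Balaban1983to89.B5DeltaA169 (DeltaA)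
open Literature.MathematicalPhysics.QuantumFieldTheory.Balaban1983to89.B5G183Strip (kappa183)
open Literature.MathematicalPhysics.QuantumFieldTheory.Balaban1983to89.B5G183CovDecay (MD183)
open Literature.MathematicalPhysics.QuantumFieldTheory.Balaban1983to89.B6LowerBound2153Torus (rep)
open Summit.QuantumFields.BalabanUV.T4Continuum
open Summit.QuantumFields.BalabanUV.T4Continuum.BalabanAveragedTowerUnit (idx)
open Summit.QuantumFields.BalabanUV.T4Continuum.NE2ColourPerturbedLayer (pertCovC)
open Summit.QuantumFields.BalabanUV.T4Continuum.DecayRateInterpolation (EntryDecay)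
open Summit.QuantumFields.BalabanUV.T4Continuum.WeightedRowSumResolvent (wrow_mul_le wrow_nonneg)
open Summit.QuantumFields.BalabanUV.T4Continuum.SmallCouplingEntryDecay (torusSupNorm_rep_triangle wrow_diagonal_le)
open Summit.QuantumFields.BalabanUV.T4Continuum.SmallCouplingEntryDecayGrad (wrow_add_le wrow_sum_le hdec_pertCovC_firstOrder)
open Summit.QuantumFields.BalabanUV.T4Continuum.GradientRowSumTransport (weighted_row_sum_fdiff_inv_le_cubic)

/-! ## §1 The abstract identity `c(S − 1)·B = (S B Sᴴ)·c(S − 1) + c·(S B Sᴴ − B)` for `SᴴS = 1` -/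

section Algebra

variable {ι : Type*} [Fintype ι] [DecidableEq ι]

/-- **`∇·B = B^{sh}·∇ + n·(B^{sh} − B)`** in abstract form: for `SᴴS = 1`, `c(S − 1)·B = (S B Sᴴ)·(c(S − 1)) + c·(S B Sᴴ − B)`. [folklore] -/
theorem smul_sub_one_mul_eq (S B : Matrix ι ι ℂ) (hS : Sᴴ * S = 1) (c : ℂ) :
    (c • (S - 1)) * B = (S * B * Sᴴ) * (c • (S - 1)) + c • (S * B * Sᴴ - B) := by
  have h1 : S * B * Sᴴ * S = S * B := by rw [Matrix.mul_assoc (S * B), hS, Matrix.mul_one]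
  rw [Matrix.smul_mul, Matrix.mul_smul, ← smul_add, Matrix.sub_mul, Matrix.one_mul, Matrix.mul_sub, Matrix.mul_one, h1]
  congr 1
  abel

end Algebra

/-! ## §2 On King's tower: `∇_ν ⊗ 1 = n·(S_ν ⊗ 1 − 1)`, the colour-lifted translation is unitary, and the regrouping -/

section Tower

variable {d : ℕ} (L : ℕ) [NeZero L] (M : Fin (d + 1) → ℕ) [hM : ∀ μ, NeZero (M μ)]
variable {o : Type*} [Fintype o] [DecidableEq o]

omit [Fintype o] in
/-- `∇_ν ⊗ 1 = c·(S_ν ⊗ 1 − 1)` on the colour-lifted indices. [folklore] -/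
theorem fdiff_kron_eq (Nf : Fin (d + 1) → ℕ) [∀ μ, NeZero (Nf μ)] (c : ℂ) (ν : Fin (d + 1)) :
    fdiff Nf c ν ⊗ₖ (1 : Matrix o o ℂ) = c • (shiftM Nf ν ⊗ₖ (1 : Matrix o o ℂ) - 1) := by
  ext ⟨i, a⟩ ⟨j, b⟩
  simp only [fdiff, Matrix.kroneckerMap_apply, Matrix.smul_apply, Matrix.sub_apply, Matrix.one_apply, Prod.mk.injEq, smul_eq_mul]
  by_cases hab : a = b
  · subst hab
    by_cases hij : i = j <;> simp [hij]
  · simp [hab]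

/-- `(S_ν ⊗ 1)ᴴ·(S_ν ⊗ 1) = 1` (the tree's `BlockPairingGeometry.conjTranspose_shiftM_mul`, colour-lifted). [folklore] -/
theorem conjTranspose_shiftK_mul (Nf : Fin (d + 1) → ℕ) [∀ μ, NeZero (Nf μ)] (ν : Fin (d + 1)) :
    (shiftM Nf ν ⊗ₖ (1 : Matrix o o ℂ))ᴴ * (shiftM Nf ν ⊗ₖ (1 : Matrix o o ℂ)) = 1 := by
  rw [Matrix.conjTranspose_kronecker, Matrix.conjTranspose_one, ← Matrix.mul_kronecker_mul,
    BlockPairingGeometry.conjTranspose_shiftM_mul, Matrix.one_mul, Matrix.one_kronecker_one]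

/-- **`(∇_ν ⊗ 1)·B = B^{sh}·(∇_ν ⊗ 1) + n_k·(B^{sh} − B)`** at level `k`, `B^{sh} = (S_ν⊗1) B (S_ν⊗1)ᴴ`. [folklore] -/
theorem fdiff_kron_mul_eq (k : ℕ) (ν : Fin (d + 1)) (B : Matrix (idx L M k × o) (idx L M k × o) ℂ) :
    (fdiff (fine (lev L k) M) ((lev L k : ℕ) : ℂ) ν ⊗ₖ (1 : Matrix o o ℂ)) * B
      = ((shiftM (fine (lev L k) M) ν ⊗ₖ (1 : Matrix o o ℂ)) * B * (shiftM (fine (lev L k) M) ν ⊗ₖ (1 : Matrix o o ℂ))ᴴ)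
          * (fdiff (fine (lev L k) M) ((lev L k : ℕ) : ℂ) ν ⊗ₖ (1 : Matrix o o ℂ))
        + ((lev L k : ℕ) : ℂ) • ((shiftM (fine (lev L k) M) ν ⊗ₖ (1 : Matrix o o ℂ)) * B
            * (shiftM (fine (lev L k) M) ν ⊗ₖ (1 : Matrix o o ℂ))ᴴ - B) := by
  rw [fdiff_kron_eq]
  exact smul_sub_one_mul_eq _ B (conjTranspose_shiftK_mul (o := o) (fine (lev L k) M) ν) _

/-- **THE REGROUPING**: `Σ_ν A_ν·(∇_ν⊗1)·B_ν + C₀ = Σ_ν (A_ν·B_ν^{sh})·(∇_ν⊗1) + (Σ_ν n_k·A_ν·(B_ν^{sh} − B_ν) + C₀)` at level `k`. [folklore] -/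
theorem sandwich_eq (k : ℕ) (A B : Fin (d + 1) → Matrix (idx L M k × o) (idx L M k × o) ℂ)
    (C₀ : Matrix (idx L M k × o) (idx L M k × o) ℂ) :
    (∑ ν, A ν * (fdiff (fine (lev L k) M) ((lev L k : ℕ) : ℂ) ν ⊗ₖ (1 : Matrix o o ℂ)) * B ν) + C₀
      = (∑ ν, (A ν * ((shiftM (fine (lev L k) M) ν ⊗ₖ (1 : Matrix o o ℂ)) * B ν
            * (shiftM (fine (lev L k) M) ν ⊗ₖ (1 : Matrix o o ℂ))ᴴ))
          * (fdiff (fine (lev L k) M) ((lev L k : ℕ) : ℂ) ν ⊗ₖ (1 : Matrix o o ℂ)))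
        + ((∑ ν, ((lev L k : ℕ) : ℂ) • (A ν * ((shiftM (fine (lev L k) M) ν ⊗ₖ (1 : Matrix o o ℂ)) * B ν
            * (shiftM (fine (lev L k) M) ν ⊗ₖ (1 : Matrix o o ℂ))ᴴ - B ν))) + C₀) := by
  rw [← add_assoc, ← Finset.sum_add_distrib]
  congr 1
  refine Finset.sum_congr rfl fun ν _ => ?_
  rw [Matrix.mul_assoc, fdiff_kron_mul_eq, Matrix.mul_add, Matrix.mul_smul]
  simp only [Matrix.mul_assoc]

omit [Fintype o] in
/-- the colour-lifted translation matrix entrywise. [folklore] -/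
theorem shiftK_apply (Nf : Fin (d + 1) → ℕ) [∀ μ, NeZero (Nf μ)] (ν : Fin (d + 1)) (i m : (Tor Nf × Fin (d + 1)) × o) :
    (shiftM Nf ν ⊗ₖ (1 : Matrix o o ℂ)) i m = if m = ((i.1.1 + unitVec Nf ν, i.1.2), i.2) then 1 else 0 := by
  obtain ⟨⟨u, μ⟩, c⟩ := i
  obtain ⟨⟨v, μ'⟩, c'⟩ := m
  rw [Matrix.kroneckerMap_apply]
  simp only [shiftM, Matrix.one_apply, Prod.mk.injEq]
  by_cases h1 : v = u + unitVec Nf ν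
  · by_cases h2 : μ' = μ
    · by_cases h3 : c = c'
      · simp [h1, h2, h3]
      · simp [h1, h2, h3, Ne.symm h3]
    · simp [h2]
  · simp [h1]

/-- **TRANSLATING A MULTIPLICATION OPERATOR**: `(S_ν⊗1)·diag(b)·(S_ν⊗1)ᴴ = diag(b ∘ σ_ν)`, `σ_ν((x,μ),c) = ((x+e_ν,μ),c)` — for right
kernels that are (colour-scalar) multiplication operators the translated kernel is again one, and `n_k·(B^{sh} − B)` is the DIAGONAL of
forward difference quotients `n_k·(b(x+e_ν) − b(x))` (the shape of an `η`-Lipschitz ∕ (3.35)-type regularity condition). [folklore] -/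
theorem shiftK_mul_diagonal_mul_conjTranspose (Nf : Fin (d + 1) → ℕ) [∀ μ, NeZero (Nf μ)] (ν : Fin (d + 1))
    (b : (Tor Nf × Fin (d + 1)) × o → ℂ) :
    (shiftM Nf ν ⊗ₖ (1 : Matrix o o ℂ)) * Matrix.diagonal b * (shiftM Nf ν ⊗ₖ (1 : Matrix o o ℂ))ᴴ
      = Matrix.diagonal (fun i => b ((i.1.1 + unitVec Nf ν, i.1.2), i.2)) := by
  ext i j
  rw [Matrix.mul_apply, Matrix.diagonal_apply,
    Finset.sum_eq_single ((i.1.1 + unitVec Nf ν, i.1.2), i.2)]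
  · rw [Matrix.mul_diagonal, Matrix.conjTranspose_apply, shiftK_apply, shiftK_apply, if_pos rfl, one_mul]
    by_cases hij : i = j
    · subst hij
      rw [if_pos rfl, if_pos rfl, star_one, mul_one]
    · have hne : ¬ ((i.1.1 + unitVec Nf ν, i.1.2), i.2) = ((j.1.1 + unitVec Nf ν, j.1.2), j.2) := by
        intro h
        simp only [Prod.mk.injEq, add_left_inj] at h
        exact hij (Prod.ext (Prod.ext h.1.1 h.1.2) h.2)
      rw [if_neg hne, if_neg hij, star_zero, mul_zero]
  · intro m _ hm
    rw [Matrix.mul_diagonal, shiftK_apply, if_neg hm, zero_mul, zero_mul]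
  · intro h; exact absurd (Finset.mem_univ _) h

/-! ## §3 `hdec` at small coupling for the sandwiched class -/

/-- **`hdec` AT SMALL COUPLING FOR SANDWICHED FIRST-ORDER MODEL PERTURBATIONS** on King's tower over a cubic unit torus `M ≡ N₀`: for
`P_k := Σ_ν A_ν k·(∇_ν ⊗ 1)·B_ν k + C₀ k` with level-uniform weighted row bounds `κ_A` (the `A_ν k`), `κ_B` (the translated right kernels
`B_ν^{sh} k = (S_ν⊗1)B_ν k(S_ν⊗1)ᴴ`), `κ_L` (the `η`-Lipschitz quotients `n_k·(B_ν^{sh} k − B_ν k)`) and `κ₀` (`C₀ k`) at a rate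
`0 ≤ δ′ < min(δ_∇, δ₁, δ₂)`, and `‖t‖·κ_w < 1` with `κ_w := (d+1)(κ_Aκ_B)·B_∇K_{d+1}(δ_∇ − δ′) + ((d+1)κ_Aκ_L + κ₀)·W_G(δ′)`:
`∀ k, EntryDecay dist₀ (pertCovC L M 1 _ P t k) (W_G(δ′)/(1 − ‖t‖κ_w)) δ′` — file 2's `hdec_pertCovC_firstOrder` on the regrouped family
(`sandwich_eq`).  MODEL level; Δ3 NOT closed; NE2 NOT proved. [folklore] -/
theorem hdec_pertCovC_sandwich {Bg δg : ℝ}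
    (hgrad : ∀ (n N₀ : ℕ) [NeZero n] [NeZero N₀] (δ' : ℝ), δ' < δg →
      ∀ (ν : Fin (d + 1)) (i : Tor (fine n (fun _ : Fin (d + 1) => N₀)) × Fin (d + 1)),
        ∑ x' : Tor (fine n (fun _ : Fin (d + 1) => N₀)) × Fin (d + 1),
            Real.exp (δ' * torusSupNorm (fun _ : Fin (d + 1) => N₀)
                (rep (fun _ : Fin (d + 1) => N₀) (blockOf n (fun _ : Fin (d + 1) => N₀) i.1)
                  - rep (fun _ : Fin (d + 1) => N₀) (blockOf n (fun _ : Fin (d + 1) => N₀) x'.1)))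
              * ‖(fdiff (fine n (fun _ : Fin (d + 1) => N₀)) (n : ℂ) ν * (DeltaA n (fun _ : Fin (d + 1) => N₀) 1)⁻¹) i x'‖
          ≤ Bg * latticeConst (d + 1) (δg - δ'))
    (N₀ : ℕ) [NeZero N₀] (hMc : M = fun _ => N₀) {δ' : ℝ} (hδ0 : 0 ≤ δ') (hδg : δ' < δg)
    (h₁ : δ' < 1 / (2 * ((d : ℝ) + 1))) (h₂ : δ' < kappa183 (d + 1) / (d + 1))
    {A B : Fin (d + 1) → (k : ℕ) → Matrix (idx L M k × o) (idx L M k × o) ℂ}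
    {C₀ : (k : ℕ) → Matrix (idx L M k × o) (idx L M k × o) ℂ} {κA κB κL κ₀ : ℝ}
    (hA : ∀ ν k (i : idx L M k × o), ∑ j, Real.exp (δ' * torusSupNorm M
        (rep M (blockOf (lev L k) M i.1.1) - rep M (blockOf (lev L k) M j.1.1))) * ‖A ν k i j‖ ≤ κA)
    (hB : ∀ ν k (i : idx L M k × o), ∑ j, Real.exp (δ' * torusSupNorm M
        (rep M (blockOf (lev L k) M i.1.1) - rep M (blockOf (lev L k) M j.1.1)))
        * ‖((shiftM (fine (lev L k) M) ν ⊗ₖ (1 : Matrix o o ℂ)) * B ν k * (shiftM (fine (lev L k) M) ν ⊗ₖ (1 : Matrix o o ℂ))ᴴ) i j‖ ≤ κB)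
    (hL : ∀ ν k (i : idx L M k × o), ∑ j, Real.exp (δ' * torusSupNorm M
        (rep M (blockOf (lev L k) M i.1.1) - rep M (blockOf (lev L k) M j.1.1)))
        * ‖(((lev L k : ℕ) : ℂ) • ((shiftM (fine (lev L k) M) ν ⊗ₖ (1 : Matrix o o ℂ)) * B ν k
            * (shiftM (fine (lev L k) M) ν ⊗ₖ (1 : Matrix o o ℂ))ᴴ - B ν k)) i j‖ ≤ κL)
    (hC₀ : ∀ k (i : idx L M k × o), ∑ j, Real.exp (δ' * torusSupNorm M
        (rep M (blockOf (lev L k) M i.1.1) - rep M (blockOf (lev L k) M j.1.1))) * ‖C₀ k i j‖ ≤ κ₀)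
    {t : ℂ} (ht : ‖t‖ * ((d + 1) * ((κA * κB) * (Bg * latticeConst (d + 1) (δg - δ')))
        + ((d + 1) * (κA * κL) + κ₀) * (2 * d * 2 ^ d * Real.exp (1 / (2 * (d + 1))) * latticeConst (d + 1) (1 / (2 * (d + 1)) - δ')
            + (d + 1) * (MD183 (d + 1) d * periodConst (kappa183 (d + 1)) d * latticeConst (d + 1) (kappa183 (d + 1) / (d + 1) - δ'))))
        < 1) (k : ℕ) :
    EntryDecay (fun x y : idx L M 0 × o => torusSupNorm M (fun ν => (((x.1.1 ν).val : ℕ) : ℤ) - (((y.1.1 ν).val : ℕ) : ℤ)))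
      (pertCovC L M 1 one_pos
        (fun k => (∑ ν, A ν k * (fdiff (fine (lev L k) M) ((lev L k : ℕ) : ℂ) ν ⊗ₖ (1 : Matrix o o ℂ)) * B ν k) + C₀ k) t k)
      ((2 * d * 2 ^ d * Real.exp (1 / (2 * (d + 1))) * latticeConst (d + 1) (1 / (2 * (d + 1)) - δ')
            + (d + 1) * (MD183 (d + 1) d * periodConst (kappa183 (d + 1)) d * latticeConst (d + 1) (kappa183 (d + 1) / (d + 1) - δ')))
          / (1 - ‖t‖ * ((d + 1) * ((κA * κB) * (Bg * latticeConst (d + 1) (δg - δ')))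
              + ((d + 1) * (κA * κL) + κ₀) * (2 * d * 2 ^ d * Real.exp (1 / (2 * (d + 1))) * latticeConst (d + 1) (1 / (2 * (d + 1)) - δ')
                + (d + 1) * (MD183 (d + 1) d * periodConst (kappa183 (d + 1)) d
                  * latticeConst (d + 1) (kappa183 (d + 1) / (d + 1) - δ')))))) δ' := by
  -- regroup the family
  have hP : (fun k => (∑ ν, A ν k * (fdiff (fine (lev L k) M) ((lev L k : ℕ) : ℂ) ν ⊗ₖ (1 : Matrix o o ℂ)) * B ν k) + C₀ k)
      = fun k => (∑ ν, (A ν k * ((shiftM (fine (lev L k) M) ν ⊗ₖ (1 : Matrix o o ℂ)) * B ν k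
            * (shiftM (fine (lev L k) M) ν ⊗ₖ (1 : Matrix o o ℂ))ᴴ))
          * (fdiff (fine (lev L k) M) ((lev L k : ℕ) : ℂ) ν ⊗ₖ (1 : Matrix o o ℂ)))
        + ((∑ ν, ((lev L k : ℕ) : ℂ) • (A ν k * ((shiftM (fine (lev L k) M) ν ⊗ₖ (1 : Matrix o o ℂ)) * B ν k
            * (shiftM (fine (lev L k) M) ν ⊗ₖ (1 : Matrix o o ℂ))ᴴ - B ν k))) + C₀ k) :=
    funext fun k => sandwich_eq L M k (fun ν => A ν k) (fun ν => B ν k) (C₀ k)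
  have hPe : pertCovC L M 1 one_pos
        (fun k => (∑ ν, A ν k * (fdiff (fine (lev L k) M) ((lev L k : ℕ) : ℂ) ν ⊗ₖ (1 : Matrix o o ℂ)) * B ν k) + C₀ k) t k
      = pertCovC L M 1 one_pos
        (fun k => (∑ ν, (A ν k * ((shiftM (fine (lev L k) M) ν ⊗ₖ (1 : Matrix o o ℂ)) * B ν k
            * (shiftM (fine (lev L k) M) ν ⊗ₖ (1 : Matrix o o ℂ))ᴴ))
          * (fdiff (fine (lev L k) M) ((lev L k : ℕ) : ℂ) ν ⊗ₖ (1 : Matrix o o ℂ)))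
        + ((∑ ν, ((lev L k : ℕ) : ℂ) • (A ν k * ((shiftM (fine (lev L k) M) ν ⊗ₖ (1 : Matrix o o ℂ)) * B ν k
            * (shiftM (fine (lev L k) M) ν ⊗ₖ (1 : Matrix o o ℂ))ᴴ - B ν k))) + C₀ k)) t k := by
    rw [hP]
  rw [hPe]
  -- the weights
  have htri : ∀ k (i j m : idx L M k × o),
      torusSupNorm M (rep M (blockOf (lev L k) M i.1.1) - rep M (blockOf (lev L k) M m.1.1))
        ≤ torusSupNorm M (rep M (blockOf (lev L k) M i.1.1) - rep M (blockOf (lev L k) M j.1.1))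
          + torusSupNorm M (rep M (blockOf (lev L k) M j.1.1) - rep M (blockOf (lev L k) M m.1.1)) :=
    fun k i j m => torusSupNorm_rep_triangle M _ _ _
  have hw : ∀ k (i j : idx L M k × o),
      0 ≤ Real.exp (δ' * torusSupNorm M (rep M (blockOf (lev L k) M i.1.1) - rep M (blockOf (lev L k) M j.1.1))) :=
    fun k i j => (Real.exp_pos _).le
  -- the left coefficients `A_ν·B_ν^{sh}`
  have hC : ∀ ν k (i : idx L M k × o), ∑ j, Real.exp (δ' * torusSupNorm M
      (rep M (blockOf (lev L k) M i.1.1) - rep M (blockOf (lev L k) M j.1.1)))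
      * ‖(A ν k * ((shiftM (fine (lev L k) M) ν ⊗ₖ (1 : Matrix o o ℂ)) * B ν k
          * (shiftM (fine (lev L k) M) ν ⊗ₖ (1 : Matrix o o ℂ))ᴴ)) i j‖ ≤ κA * κB := by
    intro ν k i
    have hκB : 0 ≤ κB := (wrow_nonneg (fun i j : idx L M k × o =>
        torusSupNorm M (rep M (blockOf (lev L k) M i.1.1) - rep M (blockOf (lev L k) M j.1.1))) δ'
      ((shiftM (fine (lev L k) M) ν ⊗ₖ (1 : Matrix o o ℂ)) * B ν k * (shiftM (fine (lev L k) M) ν ⊗ₖ (1 : Matrix o o ℂ))ᴴ)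
      i).trans (hB ν k i)
    exact (wrow_mul_le (ρ := fun i j : idx L M k × o =>
        torusSupNorm M (rep M (blockOf (lev L k) M i.1.1) - rep M (blockOf (lev L k) M j.1.1)))
      (htri k) hδ0 _ _ (hB ν k) i).trans (mul_le_mul_of_nonneg_right (hA ν k i) hκB)
  -- the zeroth-order coefficient `Σ_ν n_k·A_ν·(B_ν^{sh} − B_ν) + C₀`
  have hC₀' : ∀ k (i : idx L M k × o), ∑ j, Real.exp (δ' * torusSupNorm M
      (rep M (blockOf (lev L k) M i.1.1) - rep M (blockOf (lev L k) M j.1.1)))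
      * ‖((∑ ν, ((lev L k : ℕ) : ℂ) • (A ν k * ((shiftM (fine (lev L k) M) ν ⊗ₖ (1 : Matrix o o ℂ)) * B ν k
            * (shiftM (fine (lev L k) M) ν ⊗ₖ (1 : Matrix o o ℂ))ᴴ - B ν k))) + C₀ k) i j‖
        ≤ (d + 1) * (κA * κL) + κ₀ := by
    intro k i
    refine (wrow_add_le (fun i j : idx L M k × o => Real.exp (δ' * torusSupNorm M
      (rep M (blockOf (lev L k) M i.1.1) - rep M (blockOf (lev L k) M j.1.1)))) (hw k) _ _ i).trans (add_le_add ?_ (hC₀ k i))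
    refine (wrow_sum_le Finset.univ (fun i j : idx L M k × o => Real.exp (δ' * torusSupNorm M
      (rep M (blockOf (lev L k) M i.1.1) - rep M (blockOf (lev L k) M j.1.1)))) (hw k) _ i).trans ?_
    have hterm : ∀ ν, ∑ j, Real.exp (δ' * torusSupNorm M
        (rep M (blockOf (lev L k) M i.1.1) - rep M (blockOf (lev L k) M j.1.1)))
        * ‖(((lev L k : ℕ) : ℂ) • (A ν k * ((shiftM (fine (lev L k) M) ν ⊗ₖ (1 : Matrix o o ℂ)) * B ν k
            * (shiftM (fine (lev L k) M) ν ⊗ₖ (1 : Matrix o o ℂ))ᴴ - B ν k))) i j‖ ≤ κA * κL := by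
      intro ν
      have hκL : 0 ≤ κL := (wrow_nonneg (fun i j : idx L M k × o =>
          torusSupNorm M (rep M (blockOf (lev L k) M i.1.1) - rep M (blockOf (lev L k) M j.1.1))) δ'
        (((lev L k : ℕ) : ℂ) • ((shiftM (fine (lev L k) M) ν ⊗ₖ (1 : Matrix o o ℂ)) * B ν k
            * (shiftM (fine (lev L k) M) ν ⊗ₖ (1 : Matrix o o ℂ))ᴴ - B ν k)) i).trans (hL ν k i)
      rw [← Matrix.mul_smul]
      exact (wrow_mul_le (ρ := fun i j : idx L M k × o =>
          torusSupNorm M (rep M (blockOf (lev L k) M i.1.1) - rep M (blockOf (lev L k) M j.1.1)))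
        (htri k) hδ0 _ _ (hL ν k) i).trans (mul_le_mul_of_nonneg_right (hA ν k i) hκL)
    calc ∑ ν : Fin (d + 1), ∑ j, Real.exp (δ' * torusSupNorm M
            (rep M (blockOf (lev L k) M i.1.1) - rep M (blockOf (lev L k) M j.1.1)))
            * ‖(((lev L k : ℕ) : ℂ) • (A ν k * ((shiftM (fine (lev L k) M) ν ⊗ₖ (1 : Matrix o o ℂ)) * B ν k
                * (shiftM (fine (lev L k) M) ν ⊗ₖ (1 : Matrix o o ℂ))ᴴ - B ν k))) i j‖
        ≤ ∑ _ν : Fin (d + 1), κA * κL := Finset.sum_le_sum fun ν _ => hterm ν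
      _ = (d + 1) * (κA * κL) := by
          rw [Finset.sum_const, Finset.card_univ, Fintype.card_fin, nsmul_eq_mul]; push_cast; ring
  exact hdec_pertCovC_firstOrder L M hgrad N₀ hMc hδ0 hδg h₁ h₂
    (C := fun ν k => A ν k * ((shiftM (fine (lev L k) M) ν ⊗ₖ (1 : Matrix o o ℂ)) * B ν k
      * (shiftM (fine (lev L k) M) ν ⊗ₖ (1 : Matrix o o ℂ))ᴴ))
    (C₀ := fun k => (∑ ν, ((lev L k : ℕ) : ℂ) • (A ν k * ((shiftM (fine (lev L k) M) ν ⊗ₖ (1 : Matrix o o ℂ)) * B ν k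
      * (shiftM (fine (lev L k) M) ν ⊗ₖ (1 : Matrix o o ℂ))ᴴ - B ν k))) + C₀ k)
    hC hC₀' ht k

/-- **`hdec` FOR THE SANDWICHED CLASS, PACKAGED**: `∃ B_∇ δ_∇ > 0` depending on the dimension only (NE3's constants through file 1) such that
`hdec_pertCovC_sandwich` holds with them. [folklore] -/
theorem hdec_pertCovC_sandwich_cubic :
    ∃ Bg δg : ℝ, 0 < Bg ∧ 0 < δg ∧ ∀ (N₀ : ℕ) [NeZero N₀], M = (fun _ => N₀) →
      ∀ (δ' : ℝ), 0 ≤ δ' → δ' < δg → δ' < 1 / (2 * ((d : ℝ) + 1)) → δ' < kappa183 (d + 1) / (d + 1) →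
      ∀ (A B : Fin (d + 1) → (k : ℕ) → Matrix (idx L M k × o) (idx L M k × o) ℂ)
        (C₀ : (k : ℕ) → Matrix (idx L M k × o) (idx L M k × o) ℂ) (κA κB κL κ₀ : ℝ),
        (∀ ν k (i : idx L M k × o), ∑ j, Real.exp (δ' * torusSupNorm M
            (rep M (blockOf (lev L k) M i.1.1) - rep M (blockOf (lev L k) M j.1.1))) * ‖A ν k i j‖ ≤ κA) →
        (∀ ν k (i : idx L M k × o), ∑ j, Real.exp (δ' * torusSupNorm M
            (rep M (blockOf (lev L k) M i.1.1) - rep M (blockOf (lev L k) M j.1.1)))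
            * ‖((shiftM (fine (lev L k) M) ν ⊗ₖ (1 : Matrix o o ℂ)) * B ν k
                * (shiftM (fine (lev L k) M) ν ⊗ₖ (1 : Matrix o o ℂ))ᴴ) i j‖ ≤ κB) →
        (∀ ν k (i : idx L M k × o), ∑ j, Real.exp (δ' * torusSupNorm M
            (rep M (blockOf (lev L k) M i.1.1) - rep M (blockOf (lev L k) M j.1.1)))
            * ‖(((lev L k : ℕ) : ℂ) • ((shiftM (fine (lev L k) M) ν ⊗ₖ (1 : Matrix o o ℂ)) * B ν k
                * (shiftM (fine (lev L k) M) ν ⊗ₖ (1 : Matrix o o ℂ))ᴴ - B ν k)) i j‖ ≤ κL) →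
        (∀ k (i : idx L M k × o), ∑ j, Real.exp (δ' * torusSupNorm M
            (rep M (blockOf (lev L k) M i.1.1) - rep M (blockOf (lev L k) M j.1.1))) * ‖C₀ k i j‖ ≤ κ₀) →
        ∀ (t : ℂ), ‖t‖ * ((d + 1) * ((κA * κB) * (Bg * latticeConst (d + 1) (δg - δ')))
            + ((d + 1) * (κA * κL) + κ₀) * (2 * d * 2 ^ d * Real.exp (1 / (2 * (d + 1))) * latticeConst (d + 1) (1 / (2 * (d + 1)) - δ')
              + (d + 1) * (MD183 (d + 1) d * periodConst (kappa183 (d + 1)) d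
                * latticeConst (d + 1) (kappa183 (d + 1) / (d + 1) - δ')))) < 1 →
        ∀ (k : ℕ),
          EntryDecay (fun x y : idx L M 0 × o => torusSupNorm M (fun ν => (((x.1.1 ν).val : ℕ) : ℤ) - (((y.1.1 ν).val : ℕ) : ℤ)))
            (pertCovC L M 1 one_pos
              (fun k => (∑ ν, A ν k * (fdiff (fine (lev L k) M) ((lev L k : ℕ) : ℂ) ν ⊗ₖ (1 : Matrix o o ℂ)) * B ν k) + C₀ k) t k)
            ((2 * d * 2 ^ d * Real.exp (1 / (2 * (d + 1))) * latticeConst (d + 1) (1 / (2 * (d + 1)) - δ')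
                  + (d + 1) * (MD183 (d + 1) d * periodConst (kappa183 (d + 1)) d
                    * latticeConst (d + 1) (kappa183 (d + 1) / (d + 1) - δ')))
                / (1 - ‖t‖ * ((d + 1) * ((κA * κB) * (Bg * latticeConst (d + 1) (δg - δ')))
                    + ((d + 1) * (κA * κL) + κ₀)
                      * (2 * d * 2 ^ d * Real.exp (1 / (2 * (d + 1))) * latticeConst (d + 1) (1 / (2 * (d + 1)) - δ')
                        + (d + 1) * (MD183 (d + 1) d * periodConst (kappa183 (d + 1)) d
                          * latticeConst (d + 1) (kappa183 (d + 1) / (d + 1) - δ')))))) δ' := by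
  obtain ⟨Bg, δg, hB, hδg, hgrad⟩ := weighted_row_sum_fdiff_inv_le_cubic (d := d)
  exact ⟨Bg, δg, hB, hδg, fun N₀ _ hMc δ' hδ0 hδ' h₁ h₂ A B C₀ κA κB κL κ₀ hA hB' hL hC₀ t ht k =>
    hdec_pertCovC_sandwich L M hgrad N₀ hMc hδ0 hδ' h₁ h₂ hA hB' hL hC₀ ht k⟩

/-- kernel `example` — THE SANDWICHED CLASS IS INHABITED BY TRANSPORTER-LIKE MULTIPLIERS: `P_k = Σ_ν diag(a_ν k)·(∇_ν ⊗ 1)·diag(b_ν k)`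
with `‖a‖_∞ ≤ α`, `‖b‖_∞ ≤ β` and the `η`-LIPSCHITZ bound `n_k·|b_ν k(x + e_ν) − b_ν k(x)| ≤ λ` (level-uniform): at coupling
`‖t‖·[(d+1)αβ·B_∇K_{d+1}(δ_∇ − δ′) + (d+1)αλ·W_G(δ′)] < 1` the King-averaged colour tower has level-uniform entry decay
(`shiftK_mul_diagonal_mul_conjTranspose` + gen 5's `wrow_diagonal_le`). [folklore] -/
example {Bg δg : ℝ}
    (hgrad : ∀ (n N₀ : ℕ) [NeZero n] [NeZero N₀] (δ' : ℝ), δ' < δg →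
      ∀ (ν : Fin (d + 1)) (i : Tor (fine n (fun _ : Fin (d + 1) => N₀)) × Fin (d + 1)),
        ∑ x' : Tor (fine n (fun _ : Fin (d + 1) => N₀)) × Fin (d + 1),
            Real.exp (δ' * torusSupNorm (fun _ : Fin (d + 1) => N₀)
                (rep (fun _ : Fin (d + 1) => N₀) (blockOf n (fun _ : Fin (d + 1) => N₀) i.1)
                  - rep (fun _ : Fin (d + 1) => N₀) (blockOf n (fun _ : Fin (d + 1) => N₀) x'.1)))
              * ‖(fdiff (fine n (fun _ : Fin (d + 1) => N₀)) (n : ℂ) ν * (DeltaA n (fun _ : Fin (d + 1) => N₀) 1)⁻¹) i x'‖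
          ≤ Bg * latticeConst (d + 1) (δg - δ'))
    (N₀ : ℕ) [NeZero N₀] (hMc : M = fun _ => N₀) {δ' : ℝ} (hδ0 : 0 ≤ δ') (hδg : δ' < δg)
    (h₁ : δ' < 1 / (2 * ((d : ℝ) + 1))) (h₂ : δ' < kappa183 (d + 1) / (d + 1))
    (a b : Fin (d + 1) → (k : ℕ) → idx L M k × o → ℂ) {α β lam : ℝ}
    (ha : ∀ ν k i, ‖a ν k i‖ ≤ α) (hb : ∀ ν k i, ‖b ν k i‖ ≤ β)
    (hlip : ∀ ν k (i : idx L M k × o), ‖((lev L k : ℕ) : ℂ) * (b ν k ((i.1.1 + unitVec (fine (lev L k) M) ν, i.1.2), i.2) - b ν k i)‖ ≤ lam)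
    {t : ℂ} (ht : ‖t‖ * ((d + 1) * ((α * β) * (Bg * latticeConst (d + 1) (δg - δ')))
        + ((d + 1) * (α * lam) + 0) * (2 * d * 2 ^ d * Real.exp (1 / (2 * (d + 1))) * latticeConst (d + 1) (1 / (2 * (d + 1)) - δ')
            + (d + 1) * (MD183 (d + 1) d * periodConst (kappa183 (d + 1)) d * latticeConst (d + 1) (kappa183 (d + 1) / (d + 1) - δ'))))
        < 1) (k : ℕ) :
    EntryDecay (fun x y : idx L M 0 × o => torusSupNorm M (fun ν => (((x.1.1 ν).val : ℕ) : ℤ) - (((y.1.1 ν).val : ℕ) : ℤ)))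
      (pertCovC L M 1 one_pos
        (fun k => (∑ ν, Matrix.diagonal (a ν k) * (fdiff (fine (lev L k) M) ((lev L k : ℕ) : ℂ) ν ⊗ₖ (1 : Matrix o o ℂ))
          * Matrix.diagonal (b ν k)) + (0 : Matrix (idx L M k × o) (idx L M k × o) ℂ)) t k)
      ((2 * d * 2 ^ d * Real.exp (1 / (2 * (d + 1))) * latticeConst (d + 1) (1 / (2 * (d + 1)) - δ')
            + (d + 1) * (MD183 (d + 1) d * periodConst (kappa183 (d + 1)) d * latticeConst (d + 1) (kappa183 (d + 1) / (d + 1) - δ')))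
          / (1 - ‖t‖ * ((d + 1) * ((α * β) * (Bg * latticeConst (d + 1) (δg - δ')))
              + ((d + 1) * (α * lam) + 0) * (2 * d * 2 ^ d * Real.exp (1 / (2 * (d + 1))) * latticeConst (d + 1) (1 / (2 * (d + 1)) - δ')
            + (d + 1) * (MD183 (d + 1) d * periodConst (kappa183 (d + 1)) d * latticeConst (d + 1) (kappa183 (d + 1) / (d + 1) - δ')))))) δ' :=
  hdec_pertCovC_sandwich L M hgrad N₀ hMc hδ0 hδg h₁ h₂ (A := fun ν k => Matrix.diagonal (a ν k))
    (B := fun ν k => Matrix.diagonal (b ν k)) (C₀ := fun _ => 0)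
    (fun ν k i => wrow_diagonal_le L M (a ν k) (ha ν k) δ' i)
    (fun ν k i => by
      rw [shiftK_mul_diagonal_mul_conjTranspose]
      exact wrow_diagonal_le L M _ (fun i => hb ν k _) δ' i)
    (fun ν k i => by
      rw [shiftK_mul_diagonal_mul_conjTranspose, Matrix.diagonal_sub, ← Matrix.diagonal_smul]
      exact wrow_diagonal_le L M _ (fun i => by rw [Pi.smul_apply, smul_eq_mul]; exact hlip ν k i) δ' i)
    (fun k i => by simp) ht k

end Tower

end Summit.QuantumFields.BalabanUV.T4Continuum.SmallCouplingEntryDecaySandwich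

end
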